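import Mathlib
import Summits.Parity.BatemanHorn.Theses.PolynomialMobius
import Summits.Parity.BatemanHorn.Theorems.PolynomialMobiusPolyMobiusTailStubPairSwapCount
import Summits.Parity.BatemanHorn.Theorems.PolynomialMobiusPolyMobiusTailStubPairMiddleBoxesPart
import Summits.Parity.BatemanHorn.Theorems.PolynomialMobiusPolyMobiusTailStubPairMiddleReparam

/-!
# Crux `PolyMobiusTail` (stmt-Parity-0870), line `eta-free-multilinear-window`:
# the MIDDLE range of the linear pair window — the registered stub `stub_pair_middle`

For a Bateman–Horn pair of degree ≤ 1 and `0 < σ₁ < σ₂ < 1/2`, the part of the window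
`x^{1−η} < d₀d₁ ≤ x^{1+θ}` of the Möbius tail with `x^{σ₁} < min(d₀,d₁) ≤ x^{σ₂}` is `o(x)` for all
`θ, η ≤ c = min(σ₁/4, (1/2 − σ₂)/4, 1/16, (1 − 2σ₂)/2)`:

* `tripleSum_isLittleO` — pair-data form: small cofactors (`stub_pair_middle_small_part`) + boxes
  (`stub_pair_middle_boxes_part`) ⇒ `o(x)`;
* `oneSided_isLittleO` — through the reparametrisation `stub_pair_middle_reparam` and the `PairLinear` structure
  of a Bateman–Horn pair of degree ≤ 1;
* `stub_pair_middle` — the min-split `[x^{σ₁} < min ≤ x^{σ₂}] = [·d₀·] + [·d₁·]` on the window and the swap symmetry.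
-/

open scoped BigOperators
open Finset Real Filter Polynomial Asymptotics

namespace Summit.Parity.BatemanHorn.Theorems.PolyMobiusTail.EtaFreeWindow

namespace MiddleAssembly

open Literature.NumberTheory.Sieve Literature.NumberTheory.Sieve.GeometricGrid

set_option maxHeartbeats 800000 in
/-- **The one-sided middle triple sum is `o(x)`** (pair data form). -/
theorem tripleSum_isLittleO {q₀ a₀ q₁ a₁ : ℤ} (hq₀ : 0 < q₀) (hq₁ : 0 < q₁) (hc₀ : IsCoprime q₀ a₀)
    (hc₁ : IsCoprime q₁ a₁) (hΔ : q₁ * a₀ - q₀ * a₁ ≠ 0) {σ₁ σ₂ : ℝ} (hσ₁ : 0 < σ₁) (h12 : σ₁ < σ₂)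
    (hσ₂ : σ₂ < 1 / 2) :
    ∀ θ η : ℝ, 0 < θ → θ ≤ min (σ₁ / 4) (min ((1 / 2 - σ₂) / 4) (1 / 16)) →
      0 < η → η ≤ min (σ₁ / 4) (min ((1 / 2 - σ₂) / 4) (1 / 16)) →
      (fun x : ℕ => ∑ d₀ ∈ Icc 1 ((q₀.toNat + q₁.toNat) * x + a₀.natAbs + a₁.natAbs),
        ∑ d₁ ∈ Icc 1 ((q₀.toNat + q₁.toNat) * x + a₀.natAbs + a₁.natAbs),
          ∑ m ∈ Icc 1 ((q₀.toNat + q₁.toNat) * x + a₀.natAbs + a₁.natAbs),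
          (if ((d₁ : ℤ) * m - a₁) % q₁ = 0 ∧
              (1 ≤ ((d₁ : ℤ) * m - a₁) / q₁ ∧ ((d₁ : ℤ) * m - a₁) / q₁ ≤ x) ∧
              (1 ≤ q₀ * (((d₁ : ℤ) * m - a₁) / q₁) + a₀ ∧ (d₀ : ℤ) ∣ q₀ * (((d₁ : ℤ) * m - a₁) / q₁) + a₀) ∧
              ((x : ℝ) ^ (1 - η) < (d₀ : ℝ) * d₁ ∧ (d₀ : ℝ) * d₁ ≤ (x : ℝ) ^ (1 + θ) ∧
                ((x : ℝ) ^ σ₁ < (d₀ : ℝ) ∧ (d₀ : ℝ) ≤ (x : ℝ) ^ σ₂)) then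
            ((ArithmeticFunction.moebius d₀ : ℝ) * Real.log d₀) *
              ((ArithmeticFunction.moebius d₁ : ℝ) * Real.log d₁) else 0)) =o[atTop]
      fun x : ℕ => (x : ℝ) := by
  intro θ η hθ0 hθ hη0 hη
  have hθσ : θ ≤ σ₁ / 4 := hθ.trans (min_le_left _ _)
  obtain ⟨C₁, hC₁, c₁, X₁, hsmall⟩ := small_part_le hq₀ hq₁ hσ₁ (by linarith only [h12, hσ₂])
  obtain ⟨C₂, hC₂, e, ν, hν, X₂, hbox⟩ := boxes_part_le hq₀ hq₁ hc₀ hc₁ hΔ hσ₁ h12 hσ₂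
  set Bq : ℕ := q₀.toNat + q₁.toNat + a₀.natAbs + a₁.natAbs + 2 with hBq
  rw [Asymptotics.isLittleO_iff]
  intro ε hε
  -- thresholds making each of the three error terms `≤ (ε/3) x`
  have hpos1 : 0 < σ₁ / 4 := by linarith only [hσ₁]
  have ev1 := eventually_mul_log_pow_le_rpow (3 * C₁ / ε) (c₁ + 2) hpos1
  have ev2 := eventually_mul_log_pow_le_rpow (3 * C₂ / ε) e hν
  have ev3 : ∀ᶠ x : ℕ in atTop, 3 * C₂ / ε ≤ 1 + Real.log x := by
    have := (Real.tendsto_log_atTop.comp tendsto_natCast_atTop_atTop).eventually_ge_atTop (3 * C₂ / ε)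
    filter_upwards [this] with x hx
    simp only [Function.comp] at hx
    linarith only [hx]
  filter_upwards [eventually_ge_atTop X₁, eventually_ge_atTop X₂, eventually_ge_atTop 1,
    tendsto_natCast_atTop_atTop.eventually_ge_atTop (Bq : ℝ), ev1, ev2, ev3] with x hX₁ hX₂ hx1 hxB h1 h2 h3
  have hx1R : (1 : ℝ) ≤ x := by exact_mod_cast hx1
  have hx0R : (0 : ℝ) < x := by linarith only [hx1R]
  set L : ℝ := 1 + Real.log x with hL
  have hL1 : 1 ≤ L := by
    have : 0 ≤ Real.log x := Real.log_nonneg hx1R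
    rw [hL]; linarith only [this]
  have hL0 : 0 < L := by linarith only [hL1]
  set Xb : ℕ := (q₀.toNat + q₁.toNat) * x + a₀.natAbs + a₁.natAbs with hXb
  have hq : 1 ≤ q₀.toNat + q₁.toNat := by omega
  have hXb1 : 1 ≤ Xb := by
    have : 1 ≤ (q₀.toNat + q₁.toNat) * x := Nat.one_le_iff_ne_zero.mpr (Nat.mul_ne_zero (by omega) (by omega))
    omega
  have hxXb : x ≤ Xb := by
    have : x ≤ (q₀.toNat + q₁.toNat) * x := Nat.le_mul_of_pos_left x (by omega)
    omega
  have hXbx2 : (Xb : ℝ) ≤ (x : ℝ) ^ 2 := by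
    have hBqR : (Bq : ℝ) = (q₀.toNat : ℝ) + q₁.toNat + a₀.natAbs + a₁.natAbs + 2 := by rw [hBq]; push_cast; ring
    have hXbR : (Xb : ℝ) = ((q₀.toNat : ℝ) + q₁.toNat) * x + a₀.natAbs + a₁.natAbs := by rw [hXb]; push_cast; ring
    rw [hXbR]
    have hB : (Bq : ℝ) ≤ x := hxB
    rw [hBqR] at hB
    have ha : (0 : ℝ) ≤ a₀.natAbs := Nat.cast_nonneg _
    have hb : (0 : ℝ) ≤ a₁.natAbs := Nat.cast_nonneg _
    have h1 : ((q₀.toNat : ℝ) + q₁.toNat) * x ≤ ((x : ℝ) - a₀.natAbs - a₁.natAbs - 2) * x :=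
      mul_le_mul_of_nonneg_right (by linarith only [hB]) hx0R.le
    nlinarith only [h1, ha, hb, hx1R]
  have hXbx2' : (Xb : ℝ) ≤ (x : ℝ) ^ (2 : ℝ) := by rw [Real.rpow_two]; exact hXbx2
  -- `M₀ ≤ Xb`
  set M₀ : ℕ := ⌊(x : ℝ) ^ (σ₁ / 2)⌋₊ with hM₀
  have hM₀Xb : M₀ ≤ Xb := by
    have h1 : (M₀ : ℝ) ≤ (x : ℝ) ^ (σ₁ / 2) := Nat.floor_le (by positivity)
    have h2 : (x : ℝ) ^ (σ₁ / 2) ≤ x := by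
      calc (x : ℝ) ^ (σ₁ / 2) ≤ (x : ℝ) ^ (1 : ℝ) :=
            Real.rpow_le_rpow_of_exponent_le hx1R (by linarith only [h12, hσ₂, hσ₁])
        _ = x := Real.rpow_one _
    have : M₀ ≤ x := by exact_mod_cast h1.trans h2
    exact this.trans hxXb
  -- split the `m`-sum
  rw [Finset.sum_congr rfl fun d₀ _ => Finset.sum_congr rfl fun d₁ _ => sum_Icc_one_eq_add hM₀Xb _]
  simp only [Finset.sum_add_distrib]
  have hS := hsmall x Xb σ₂ θ η hX₁ hθσ hXb1 hXbx2
  have hB := hbox x θ η hX₂ hθ0 hθ hη0 hη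
  -- the three error terms are each `≤ (ε/3) x`
  have hε3 : 0 < ε / 3 := by linarith only [hε]
  have hT1 : C₁ * L ^ (c₁ + 2) * (x : ℝ) ^ (1 - σ₁ / 4) ≤ ε / 3 * x := by
    -- `(3C₁/ε) L^{c₁+2} ≤ x^{σ₁/4}` ⟹ `C₁ L^{c₁+2} x^{1-σ₁/4} ≤ (ε/3) x`
    have hx1 : (x : ℝ) ^ (1 - σ₁ / 4) * (x : ℝ) ^ (σ₁ / 4) = x := by
      rw [← Real.rpow_add hx0R]; norm_num
    have hp : 0 ≤ (x : ℝ) ^ (1 - σ₁ / 4) := by positivity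
    have h4 : C₁ * L ^ (c₁ + 2) ≤ ε / 3 * (x : ℝ) ^ (σ₁ / 4) := by
      have := h1
      rw [div_mul_eq_mul_div, div_le_iff₀ hε] at this
      nlinarith only [this, hε]
    calc C₁ * L ^ (c₁ + 2) * (x : ℝ) ^ (1 - σ₁ / 4) ≤ ε / 3 * (x : ℝ) ^ (σ₁ / 4) * (x : ℝ) ^ (1 - σ₁ / 4) :=
          mul_le_mul_of_nonneg_right h4 hp
      _ = ε / 3 * x := by rw [mul_assoc, mul_comm ((x : ℝ) ^ (σ₁ / 4)), hx1]
  have hT2 : C₂ * (L ^ e * (x : ℝ) ^ (1 - ν)) ≤ ε / 3 * x := by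
    have hx1 : (x : ℝ) ^ (1 - ν) * (x : ℝ) ^ ν = x := by
      rw [← Real.rpow_add hx0R]; norm_num
    have hp : 0 ≤ (x : ℝ) ^ (1 - ν) := by positivity
    have h4 : C₂ * L ^ e ≤ ε / 3 * (x : ℝ) ^ ν := by
      have := h2
      rw [div_mul_eq_mul_div, div_le_iff₀ hε] at this
      nlinarith only [this, hε]
    calc C₂ * (L ^ e * (x : ℝ) ^ (1 - ν)) = C₂ * L ^ e * (x : ℝ) ^ (1 - ν) := by ring
      _ ≤ ε / 3 * (x : ℝ) ^ ν * (x : ℝ) ^ (1 - ν) := mul_le_mul_of_nonneg_right h4 hp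
      _ = ε / 3 * x := by rw [mul_assoc, mul_comm ((x : ℝ) ^ ν), hx1]
  have hT3 : C₂ * ((x : ℝ) / L) ≤ ε / 3 * x := by
    rw [mul_div_assoc', div_le_iff₀ hL0]
    have h4 : 3 * C₂ ≤ ε * L := by
      have := h3; rw [div_le_iff₀ hε] at this; linarith only [this]
    nlinarith only [h4, hx0R]
  have hB' : C₂ * ((x : ℝ) / (1 + Real.log x) + (1 + Real.log x) ^ e * (x : ℝ) ^ (1 - ν)) ≤ ε / 3 * x + ε / 3 * x := by
    rw [← hL, mul_add]; exact add_le_add hT3 hT2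
  rw [Real.norm_of_nonneg (Nat.cast_nonneg x)]
  calc ‖(∑ d₀ ∈ Icc 1 Xb, ∑ d₁ ∈ Icc 1 Xb, ∑ m ∈ Icc 1 M₀, _) + (∑ d₀ ∈ Icc 1 Xb, ∑ d₁ ∈ Icc 1 Xb, ∑ m ∈ Ioc M₀ Xb, _)‖
      ≤ |∑ d₀ ∈ Icc 1 Xb, ∑ d₁ ∈ Icc 1 Xb, ∑ m ∈ Icc 1 M₀, _| + |∑ d₀ ∈ Icc 1 Xb, ∑ d₁ ∈ Icc 1 Xb, ∑ m ∈ Ioc M₀ Xb, _| := by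
        rw [Real.norm_eq_abs]; exact abs_add_le _ _
    _ ≤ C₁ * (1 + Real.log x) ^ (c₁ + 2) * (x : ℝ) ^ (1 - σ₁ / 4) +
        C₂ * ((x : ℝ) / (1 + Real.log x) + (1 + Real.log x) ^ e * (x : ℝ) ^ (1 - ν)) := add_le_add hS hB
    _ ≤ ε / 3 * x + (ε / 3 * x + ε / 3 * x) := by rw [← hL] at hB' ⊢; exact add_le_add hT1 hB'
    _ = ε * x := by ring

end MiddleAssembly

open Literature.NumberTheory.Sieve

/-- **Piece (swap).** The mirrored one-sided sum (conditions on `d 1`) of `f` is the one-sided sum of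
`f ∘ Equiv.swap 0 1`. -/
theorem piece_swap (f : Fin 2 → ℤ[X]) (σ₁ σ₂ θ η : ℝ) (x : ℕ) :
    (∑ n ∈ Finset.Icc 1 x, ∑ d ∈ Fintype.piFinset (fun i => (((f i).eval (n : ℤ)).toNat).divisors),
      if (x : ℝ) ^ (1 - η) < ∏ i, (d i : ℝ) ∧ ∏ i, (d i : ℝ) ≤ (x : ℝ) ^ (1 + θ) ∧
          ((x : ℝ) ^ σ₁ < (d 1 : ℝ) ∧ (d 1 : ℝ) ≤ (x : ℝ) ^ σ₂) then
          (∏ i, ((ArithmeticFunction.moebius (d i) : ℝ) * Real.log (d i))) else 0) =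
    (∑ n ∈ Finset.Icc 1 x, ∑ d ∈ Fintype.piFinset (fun i => ((((f ∘ Equiv.swap (0 : Fin 2) 1) i).eval (n : ℤ)).toNat).divisors),
      if (x : ℝ) ^ (1 - η) < ∏ i, (d i : ℝ) ∧ ∏ i, (d i : ℝ) ≤ (x : ℝ) ^ (1 + θ) ∧
          ((x : ℝ) ^ σ₁ < (d 0 : ℝ) ∧ (d 0 : ℝ) ≤ (x : ℝ) ^ σ₂) then
        (∏ i, ((ArithmeticFunction.moebius (d i) : ℝ) * Real.log (d i))) else 0) := by
  refine Finset.sum_congr rfl fun n _ => ?_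
  set e : Equiv.Perm (Fin 2) := Equiv.swap (0 : Fin 2) 1 with he
  set t : Fin 2 → Finset ℕ := fun i => (((f i).eval (n : ℤ)).toNat).divisors with ht
  have hmem : ∀ d : Fin 2 → ℕ, d ∈ Fintype.piFinset t →
      (d ∘ e) ∈ Fintype.piFinset (fun i => ((((f ∘ e) i).eval (n : ℤ)).toNat).divisors) := by
    intro d hd
    rw [Fintype.mem_piFinset] at hd ⊢
    intro i
    exact hd (e i)
  have hmem' : ∀ d : Fin 2 → ℕ, d ∈ Fintype.piFinset (fun i => ((((f ∘ e) i).eval (n : ℤ)).toNat).divisors) →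
      (d ∘ e) ∈ Fintype.piFinset t := by
    intro d hd
    rw [Fintype.mem_piFinset] at hd ⊢
    intro i
    have := hd (e i)
    simpa [ht, he, Function.comp, Equiv.swap_apply_self] using this
  have hinv : ∀ d : Fin 2 → ℕ, (d ∘ e) ∘ e = d := by
    intro d; funext i; simp [he, Function.comp, Equiv.swap_apply_self]
  refine Finset.sum_nbij' (fun d => d ∘ e) (fun d => d ∘ e) hmem hmem' (fun d _ => hinv d)
    (fun d _ => hinv d) ?_
  intro d _
  have hprod : ∏ i, ((d ∘ e) i : ℝ) = ∏ i, (d i : ℝ) := Equiv.prod_comp e (fun i => (d i : ℝ))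
  have hw : (∏ i, ((ArithmeticFunction.moebius ((d ∘ e) i) : ℝ) * Real.log ((d ∘ e) i))) =
      (∏ i, ((ArithmeticFunction.moebius (d i) : ℝ) * Real.log (d i))) :=
    Equiv.prod_comp e (fun i => ((ArithmeticFunction.moebius (d i) : ℝ) * Real.log (d i)))
  have h0 : (d ∘ e) 0 = d 1 := by simp [he]
  rw [hprod, hw, h0]


/-- `IsBatemanHornSystem` is invariant under reindexing by the swap of `Fin 2`. -/
theorem isBatemanHornSystem_swap {f : Fin 2 → ℤ[X]} (hf : IsBatemanHornSystem f) :
    IsBatemanHornSystem (f ∘ Equiv.swap (0 : Fin 2) 1) := by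
  set e : Equiv.Perm (Fin 2) := Equiv.swap (0 : Fin 2) 1 with he
  refine ⟨fun i => hf.irreducible (e i), fun i => hf.leadingCoeff_pos (e i),
    fun i j hij => hf.pairwise_not_associated (e.injective.ne hij), ?_⟩
  intro p hp
  have hcount : polyRootCountMod (f ∘ e) p = polyRootCountMod f p := by
    unfold polyRootCountMod
    congr 1
    refine Finset.filter_congr fun m _ => ?_
    rw [show (∏ i, ((f ∘ e) i).eval (m : ℤ)) = ∏ i, (f i).eval (m : ℤ) from
      Equiv.prod_comp e (fun i => (f i).eval (m : ℤ))]
  rw [hcount]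
  exact hf.hasNoFixedPrimeDivisor p hp


/-- **Piece (min split), pointwise.** For `1 ≤ x`, `η < 1 − 2σ₂` and a divisor pair `d` INSIDE the window
`x^{1-η} < d₀d₁`, the condition `x^{σ₁} < min(d₀,d₁) ≤ x^{σ₂}` is the disjoint disjunction of
`x^{σ₁} < d₀ ≤ x^{σ₂}` and `x^{σ₁} < d₁ ≤ x^{σ₂}`. -/
theorem piece_min_split {x : ℕ} (hx : (1 : ℝ) ≤ x) {σ₁ σ₂ η : ℝ} (hη : η ≤ 1 - 2 * σ₂)
    (d : Fin 2 → ℕ) (hwin : (x : ℝ) ^ (1 - η) < ∏ i, (d i : ℝ)) (w : ℝ) :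
    (if (x : ℝ) ^ σ₁ < ((min (d 0) (d 1) : ℕ) : ℝ) ∧ ((min (d 0) (d 1) : ℕ) : ℝ) ≤ (x : ℝ) ^ σ₂ then w else 0) =
      (if (x : ℝ) ^ σ₁ < (d 0 : ℝ) ∧ (d 0 : ℝ) ≤ (x : ℝ) ^ σ₂ then w else 0) +
      (if (x : ℝ) ^ σ₁ < (d 1 : ℝ) ∧ (d 1 : ℝ) ≤ (x : ℝ) ^ σ₂ then w else 0) := by
  have hprod : ∏ i, (d i : ℝ) = (d 0 : ℝ) * (d 1 : ℝ) := Fin.prod_univ_two _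
  rw [hprod] at hwin
  have hx0 : (0 : ℝ) < x := by linarith
  -- not both `d 0 ≤ x^{σ₂}` and `d 1 ≤ x^{σ₂}` (else `d₀d₁ ≤ x^{2σ₂} ≤ x^{1-η}`)
  have hnot : ¬ ((d 0 : ℝ) ≤ (x : ℝ) ^ σ₂ ∧ (d 1 : ℝ) ≤ (x : ℝ) ^ σ₂) := by
    rintro ⟨h0, h1⟩
    have hle : (d 0 : ℝ) * (d 1 : ℝ) ≤ (x : ℝ) ^ σ₂ * (x : ℝ) ^ σ₂ :=
      mul_le_mul h0 h1 (by positivity) (by positivity)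
    have hpow : (x : ℝ) ^ σ₂ * (x : ℝ) ^ σ₂ ≤ (x : ℝ) ^ (1 - η) := by
      rw [← Real.rpow_add hx0]
      exact Real.rpow_le_rpow_of_exponent_le hx (by linarith)
    linarith
  have hmin : ((min (d 0) (d 1) : ℕ) : ℝ) = min (d 0 : ℝ) (d 1 : ℝ) := Nat.cast_min _ _
  rw [hmin]
  by_cases hA : (x : ℝ) ^ σ₁ < (d 0 : ℝ) ∧ (d 0 : ℝ) ≤ (x : ℝ) ^ σ₂
  · -- then `d 0 ≤ d 1`, the min is `d 0`, and `B` fails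
    have h01 : (d 0 : ℝ) ≤ (d 1 : ℝ) := by
      by_contra h
      push Not at h
      exact hnot ⟨hA.2, h.le.trans hA.2⟩
    have hB : ¬ ((x : ℝ) ^ σ₁ < (d 1 : ℝ) ∧ (d 1 : ℝ) ≤ (x : ℝ) ^ σ₂) := fun h => hnot ⟨hA.2, h.2⟩
    rw [min_eq_left h01, if_pos hA, if_neg hB, add_zero]
  · by_cases hB : (x : ℝ) ^ σ₁ < (d 1 : ℝ) ∧ (d 1 : ℝ) ≤ (x : ℝ) ^ σ₂
    · have h10 : (d 1 : ℝ) ≤ (d 0 : ℝ) := by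
        by_contra h
        push Not at h
        exact hnot ⟨h.le.trans hB.2, hB.2⟩
      rw [min_eq_right h10, if_pos hB, if_neg hA, zero_add]
    · have hL : ¬ ((x : ℝ) ^ σ₁ < min (d 0 : ℝ) (d 1 : ℝ) ∧ min (d 0 : ℝ) (d 1 : ℝ) ≤ (x : ℝ) ^ σ₂) := by
        intro h
        rcases le_total (d 0 : ℝ) (d 1 : ℝ) with h01 | h10
        · rw [min_eq_left h01] at h; exact hA h
        · rw [min_eq_right h10] at h; exact hB h
      rw [if_neg hL, if_neg hA, if_neg hB, add_zero]


/-- **The one-sided middle sum of a Bateman–Horn pair of degree ≤ 1 is `o(x)`** (condition on `d 0`):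
from `tripleSum_isLittleO` through the reparametrisation `oneSided_eq_tripleSum`. -/
theorem oneSided_isLittleO : ∀ (f : Fin 2 → ℤ[X]), IsBatemanHornSystem f → (∀ i, (f i).natDegree ≤ 1) →
    ∀ σ₁ σ₂ : ℝ, 0 < σ₁ → σ₁ < σ₂ → σ₂ < 1 / 2 →
    ∃ c : ℝ, 0 < c ∧ ∀ θ η : ℝ, 0 < θ → θ ≤ c → 0 < η → η ≤ c →
      (fun x : ℕ => ∑ n ∈ Finset.Icc 1 x,
        ∑ d ∈ Fintype.piFinset (fun i => (((f i).eval (n : ℤ)).toNat).divisors),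
          if (x : ℝ) ^ (1 - η) < ∏ i, (d i : ℝ) ∧ ∏ i, (d i : ℝ) ≤ (x : ℝ) ^ (1 + θ) ∧
              ((x : ℝ) ^ σ₁ < (d 0 : ℝ) ∧ (d 0 : ℝ) ≤ (x : ℝ) ^ σ₂) then
            (∏ i, ((ArithmeticFunction.moebius (d i) : ℝ) * Real.log (d i))) else 0)
        =o[atTop] fun x : ℕ => (x : ℝ) := by
  intro f hf hlin σ₁ σ₂ h1 h12 h2
  have hdeg : ∀ i, (f i).natDegree = 1 := PairLinear.natDegree_eq_one hf hlin
  set q₀ : ℤ := (f 0).leadingCoeff with hq₀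
  set q₁ : ℤ := (f 1).leadingCoeff with hq₁
  set a₀ : ℤ := (f 0).coeff 0 with ha₀
  set a₁ : ℤ := (f 1).coeff 0 with ha₁
  have hq₀p : 0 < q₀ := hf.leadingCoeff_pos 0
  have hq₁p : 0 < q₁ := hf.leadingCoeff_pos 1
  have hc₀ : IsCoprime q₀ a₀ := PairLinear.isCoprime_leadingCoeff_coeff_zero hf (hdeg 0)
  have hc₁ : IsCoprime q₁ a₁ := PairLinear.isCoprime_leadingCoeff_coeff_zero hf (hdeg 1)
  have hΔ : q₁ * a₀ - q₀ * a₁ ≠ 0 := PairLinear.resultant_ne_zero hf hdeg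
  refine ⟨min (σ₁ / 4) (min ((1 / 2 - σ₂) / 4) (1 / 16)), lt_min (by linarith) (lt_min (by linarith) (by norm_num)), ?_⟩
  intro θ η hθ0 hθ hη0 hη
  have hT := MiddleAssembly.tripleSum_isLittleO hq₀p hq₁p hc₀ hc₁ hΔ h1 h12 h2 θ η hθ0 hθ hη0 hη
  refine hT.congr_left fun x => ?_
  exact (MiddleAssembly.oneSided_eq_tripleSum f hdeg (fun i => hf.leadingCoeff_pos i) σ₁ σ₂ θ η x
    ((q₀.toNat + q₁.toNat) * x + a₀.natAbs + a₁.natAbs) le_rfl).symm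

/-- **S1b-P2 · the MIDDLE range of the linear pair window (registered stub `stub_pair_middle`)**, assembled from the one-sided dispersion bound (`oneSided_isLittleO`) for `f` and for `f ∘ swap`, and the pointwise min-split. -/
theorem stub_pair_middle : ∀ (f : Fin 2 → ℤ[X]), IsBatemanHornSystem f → (∀ i, (f i).natDegree ≤ 1) →
    ∀ σ₁ σ₂ : ℝ, 0 < σ₁ → σ₁ < σ₂ → σ₂ < 1 / 2 →
    ∃ c : ℝ, 0 < c ∧ ∀ θ η : ℝ, 0 < θ → θ ≤ c → 0 < η → η ≤ c →
      (fun x : ℕ => ∑ n ∈ Finset.Icc 1 x,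
        ∑ d ∈ Fintype.piFinset (fun i => (((f i).eval (n : ℤ)).toNat).divisors),
          if (x : ℝ) ^ (1 - η) < ∏ i, (d i : ℝ) ∧ ∏ i, (d i : ℝ) ≤ (x : ℝ) ^ (1 + θ) ∧
              ((x : ℝ) ^ σ₁ < ((min (d 0) (d 1) : ℕ) : ℝ) ∧ ((min (d 0) (d 1) : ℕ) : ℝ) ≤ (x : ℝ) ^ σ₂) then
            ∏ i, ((ArithmeticFunction.moebius (d i) : ℝ) * Real.log (d i)) else 0)
        =o[atTop] fun x : ℕ => (x : ℝ) := by
  intro f hf hlin σ₁ σ₂ h1 h12 h2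
  obtain ⟨c₁, hc₁, hA⟩ := oneSided_isLittleO f hf hlin σ₁ σ₂ h1 h12 h2
  have hf' : IsBatemanHornSystem (f ∘ Equiv.swap (0 : Fin 2) 1) := isBatemanHornSystem_swap hf
  have hlin' : ∀ i, ((f ∘ Equiv.swap (0 : Fin 2) 1) i).natDegree ≤ 1 := fun i => hlin _
  obtain ⟨c₂, hc₂, hB⟩ := oneSided_isLittleO _ hf' hlin' σ₁ σ₂ h1 h12 h2
  set c : ℝ := min (min c₁ c₂) ((1 - 2 * σ₂) / 2) with hc_def
  have hσpos : 0 < (1 - 2 * σ₂) / 2 := by linarith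
  have hc0 : 0 < c := lt_min (lt_min hc₁ hc₂) hσpos
  have hcc₁ : c ≤ c₁ := (min_le_left _ _).trans (min_le_left _ _)
  have hcc₂ : c ≤ c₂ := (min_le_left _ _).trans (min_le_right _ _)
  have hcσ : c ≤ (1 - 2 * σ₂) / 2 := min_le_right _ _
  refine ⟨c, hc0, fun θ η hθ hθc hη hηc => ?_⟩
  have H := (hA θ η hθ (hθc.trans hcc₁) hη (hηc.trans hcc₁)).add
    (hB θ η hθ (hθc.trans hcc₂) hη (hηc.trans hcc₂))
  refine H.congr_left fun x => ?_
  have hη' : η ≤ 1 - 2 * σ₂ := by linarith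
  rw [← piece_swap f σ₁ σ₂ θ η x]
  rw [← Finset.sum_add_distrib]
  refine Finset.sum_congr rfl fun n hn => ?_
  rw [← Finset.sum_add_distrib]
  refine Finset.sum_congr rfl fun d _ => ?_
  have hx1 : (1 : ℝ) ≤ (x : ℝ) := by
    have h := Finset.mem_Icc.mp hn
    exact_mod_cast h.1.trans h.2
  symm
  by_cases hW : (x : ℝ) ^ (1 - η) < ∏ i, (d i : ℝ) ∧ ∏ i, (d i : ℝ) ≤ (x : ℝ) ^ (1 + θ)
  · have key := piece_min_split (σ₁ := σ₁) hx1 hη' d hW.1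
      (∏ i, ((ArithmeticFunction.moebius (d i) : ℝ) * Real.log (d i)))
    by_cases hL : (x : ℝ) ^ σ₁ < ((min (d 0) (d 1) : ℕ) : ℝ) ∧ ((min (d 0) (d 1) : ℕ) : ℝ) ≤ (x : ℝ) ^ σ₂
    · by_cases hA' : (x : ℝ) ^ σ₁ < (d 0 : ℝ) ∧ (d 0 : ℝ) ≤ (x : ℝ) ^ σ₂
      · by_cases hB' : (x : ℝ) ^ σ₁ < (d 1 : ℝ) ∧ (d 1 : ℝ) ≤ (x : ℝ) ^ σ₂
        · rw [if_pos hL, if_pos hA', if_pos hB'] at key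
          rw [if_pos ⟨hW.1, hW.2, hL⟩, if_pos ⟨hW.1, hW.2, hA'⟩, if_pos ⟨hW.1, hW.2, hB'⟩]
          exact key
        · rw [if_pos hL, if_pos hA', if_neg hB'] at key
          rw [if_pos ⟨hW.1, hW.2, hL⟩, if_pos ⟨hW.1, hW.2, hA'⟩, if_neg (fun h => hB' h.2.2)]
          exact key
      · by_cases hB' : (x : ℝ) ^ σ₁ < (d 1 : ℝ) ∧ (d 1 : ℝ) ≤ (x : ℝ) ^ σ₂
        · rw [if_pos hL, if_neg hA', if_pos hB'] at key
          rw [if_pos ⟨hW.1, hW.2, hL⟩, if_neg (fun h => hA' h.2.2), if_pos ⟨hW.1, hW.2, hB'⟩]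
          exact key
        · rw [if_pos hL, if_neg hA', if_neg hB'] at key
          rw [if_pos ⟨hW.1, hW.2, hL⟩, if_neg (fun h => hA' h.2.2), if_neg (fun h => hB' h.2.2)]
          exact key
    · by_cases hA' : (x : ℝ) ^ σ₁ < (d 0 : ℝ) ∧ (d 0 : ℝ) ≤ (x : ℝ) ^ σ₂
      · by_cases hB' : (x : ℝ) ^ σ₁ < (d 1 : ℝ) ∧ (d 1 : ℝ) ≤ (x : ℝ) ^ σ₂
        · rw [if_neg hL, if_pos hA', if_pos hB'] at key
          rw [if_neg (fun h => hL h.2.2), if_pos ⟨hW.1, hW.2, hA'⟩, if_pos ⟨hW.1, hW.2, hB'⟩]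
          exact key
        · rw [if_neg hL, if_pos hA', if_neg hB'] at key
          rw [if_neg (fun h => hL h.2.2), if_pos ⟨hW.1, hW.2, hA'⟩, if_neg (fun h => hB' h.2.2)]
          exact key
      · by_cases hB' : (x : ℝ) ^ σ₁ < (d 1 : ℝ) ∧ (d 1 : ℝ) ≤ (x : ℝ) ^ σ₂
        · rw [if_neg hL, if_neg hA', if_pos hB'] at key
          rw [if_neg (fun h => hL h.2.2), if_neg (fun h => hA' h.2.2), if_pos ⟨hW.1, hW.2, hB'⟩]
          exact key
        · rw [if_neg (fun h => hL h.2.2), if_neg (fun h => hA' h.2.2), if_neg (fun h => hB' h.2.2)]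
          ring
  · rw [if_neg (fun h => hW ⟨h.1, h.2.1⟩), if_neg (fun h => hW ⟨h.1, h.2.1⟩),
      if_neg (fun h => hW ⟨h.1, h.2.1⟩)]
    ring



end Summit.Parity.BatemanHorn.Theorems.PolyMobiusTail.EtaFreeWindow
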